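import Summits.ABC.StewartYu.PadicG3OddLines
import Summits.ABC.StewartYu.PadicG3OneExpLines
import Summits.ABC.StewartYu.PadicG3OddHeadline1
import Summits.ABC.StewartYu.PadicG3CountRb
import Summits.ABC.StewartYu.PadicG3ExpLine
import HarnessLib

/-!
# Cell abc-stewartyu, crux `Y07Odd` (stmt-ABC-19658), line `gen3-slab-odd`, branch `m ≥ 1`: ASSEMBLY of the registered stub `stub_ineqs1`
# from the four GAIN LINES at the v1 schedule `P.sched1b 1` (Part B glue; everything else is in the tree)

`Summits/ABC/StewartYu/PadicG3OneAssembly.lean` — cell `abc-stewartyu` (HOME `run/shared/lean/pub/abc-stewartyu/`), seat p5 (g4).  One theorem,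
no named fact: **`ineqs1_of_gainLines`** — the registered stub `stub_ineqs1 : CTX → 1 ≤ P.m → ∃ b, 1 ≤ b ∧ S.IneqPackR₃ (P.sched1b b)` of the crux
skeleton (p2-g4, 2026-08-27T05:52Z) with `b := 1`, MODULO the four gain lines `hgainK0 / hgainH / hgainO / hgainK` of `G3Setup.ineqPackR₃_of_lines`
at `Sc := P.sched1b 1` (Part A: p1 g8 for the k-step families, p4 g4 for the half-step family), which enter as hypotheses in exactly that shape.
Inside: (B1) = lp-1's `startCountR₂_sched1b_one`; the smallness exponent `E := ⌊(16·2ⁿ·GXL − W)/log p⌋` via p2's `expLine_of_negBound` and lp-1's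
headline `headline_odd1_div_log_lit` (`2·(8·2ⁿ·GXL) ≤ (2^100)ⁿ·(p/log p)·Ω·W⁺`); the exponent lines = `hexp*_sched1b` (`PadicG3OneExpLines`, needing
`11·2ⁿ·GXL ≤ E·log p`, which holds since `W ≤ GXL/64` and `log p ≤ G ≤ GXL/1152`).

References: Yu. V. Nesterenko, LNM 1819 (2003) Prop 4.1; K. Yu, Acta Math. 211 (2013) §7.
-/

noncomputable section

open NormedSpace Finset Polynomial
open Literature.NumberTheory.Transcendental
open Literature.NumberTheory.Transcendental.PadicCW77 (condExp)
open Literature.NumberTheory.Transcendental.CW77.Setup (Tau tauNorm)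
open scoped Nat

namespace Summit.ABC.StewartYu

namespace G3Setup

variable {p : ℕ} [Fact p.Prime] (S : G3Setup p)

/-- **The `m ≥ 1` inequality stub from its four gain lines** (registered CTX of `stub_ineqs1`, `b := 1`).
[cite: Nesterenko2003, Prop 4.1, §4.2–§4.3; shape only] -/
theorem ineqs1_of_gainLines (hp2 : p ≠ 2) (hn2 : 2 ≤ S.n) (V : Fin S.n → ℝ) (Vmax W : ℝ)
    (_hv : ∀ j, padicValRat p (S.α j) = 0)
    (_hkum : ∀ κ : Fin S.n → ℤ, (∃ γ : ℚ, ∏ j, S.α j ^ κ j = γ ^ 2 ∨ ∏ j, S.α j ^ κ j = -γ ^ 2) → ∀ j, (2 : ℤ) ∣ κ j)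
    (_hV : ∀ j, Height.logHeight₁ (S.α j) ≤ V j) (hV1 : ∀ j, 1 ≤ V j) (_hVm : ∀ j, V j ≤ Vmax)
    (hWb : ∀ j, Real.log (max 3 (|S.b j| : ℝ)) ≤ W) (_hW : 1 ≤ W)
    (hU : ¬ (padicValRat p (∏ j, S.α j ^ S.b j - 1) : ℝ) * Real.log p ≤
        ((2 : ℝ) ^ 100) ^ S.n * ((p : ℝ) / Real.log p) * (∏ j, V j) * (W + Real.log p + Real.log (2 * Vmax)))
    (P : PadicG3Par S.n) (hPp : P.p = p) (hPA : P.A = V) (hAmaxV : P.Amax ≤ Vmax) (hAmaxΩ : P.Amax ≤ 2 ^ S.n * (∏ j, V j)) (hPW : P.W = W)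
    (hNq : P.Nq = P.K) (hK₀ : P.K₀ = p - 1) (hθ : P.θ₀ = 1 / 2) (hm : 1 ≤ P.m)
    (hgainK0 : ∀ ν < S.n, ∀ x₁ : ℤ, |x₁| ≤ (S.NS (P.sched1b 1) 0 (ν + 1) : ℤ) →
      ∀ τ : Tau S.n, tauNorm τ + S.tS (P.sched1b 1) 0 ≤ S.TordS (P.sched1b 1) 0 ν →
      Real.log (BwP (p := p) (P.sched1b 1).L₀ (P.sched1b 1).m) +
        Real.log (S.KC (S.UcardS₂ (P.sched1b 1)) (S.PmaxS₂ (P.sched1b 1)) (P.sched1b 1).L₀ (P.sched1b 1).H (P.sched1b 1).Sd 0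
          (S.Lb (S.sideS₂ (P.sched1b 1)) 0) x₁ τ) <
        (((2 * S.NS (P.sched1b 1) 0 ν + 1) * S.tS (P.sched1b 1) 0 : ℕ) : ℝ) * ((((P.sched1b 1).m : ℝ) + 1 / 2) * Real.log p))
    (hgainH : ∀ lev < (P.sched1b 1).Sd, ∀ s₁ : ℤ, Odd s₁ → |s₁| ≤ (2 * S.NhS (P.sched1b 1) (lev + 1) - 1 : ℤ) →
      ∀ τ : Tau S.n, tauNorm τ + S.tS (P.sched1b 1) lev ≤ S.TordS (P.sched1b 1) lev S.n →
      Real.log (BwP (p := p) (P.sched1b 1).L₀ (P.sched1b 1).m) +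
          (((2 ^ (S.n + 1) : ℕ) : ℝ)) * (Real.log 4 + 2 * Real.log (S.DCs (S.Lb (S.sideS₂ (P.sched1b 1)) lev) (P.sched1b 1).H s₁ τ : ℝ) +
            Real.log (1 + (S.UcardS₂ (P.sched1b 1) : ℝ) * (S.PmaxS₂ (P.sched1b 1)) *
              S.MhCs (S.Lb (S.sideS₂ (P.sched1b 1)) lev) (P.sched1b 1).L₀ (P.sched1b 1).H (P.sched1b 1).Sd lev s₁ τ) +
            3 * Real.log (CW77.heightProd S.α)) -
          Real.log (S.DCs (S.Lb (S.sideS₂ (P.sched1b 1)) lev) (P.sched1b 1).H s₁ τ : ℝ) <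
        (((2 * S.NS (P.sched1b 1) lev S.n + 1) * S.tS (P.sched1b 1) lev : ℕ) : ℝ) * ((((P.sched1b 1).m : ℝ) + 1 / 2) * Real.log p))
    (hgainO : ∀ lev < (P.sched1b 1).Sd, ∀ x₁ : ℤ, |x₁| ≤ (S.NS (P.sched1b 1) (lev + 1) 1 : ℤ) →
      ∀ τ : Tau S.n, tauNorm τ + S.tS (P.sched1b 1) (lev + 1) ≤ S.TordS (P.sched1b 1) (lev + 1) 0 →
      Real.log (BwP (p := p) (P.sched1b 1).L₀ (P.sched1b 1).m) +
        Real.log (S.KC (S.UcardS₂ (P.sched1b 1)) (S.PmaxS₂ (P.sched1b 1)) (P.sched1b 1).L₀ (P.sched1b 1).H (P.sched1b 1).Sd (lev + 1)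
          (S.Lb (S.sideS₂ (P.sched1b 1)) (lev + 1)) x₁ τ) <
        (((2 * S.NhS (P.sched1b 1) (lev + 1)) * S.tS (P.sched1b 1) (lev + 1) : ℕ) : ℝ) * ((((P.sched1b 1).m : ℝ) + 1 / 2) * Real.log p))
    (hgainK : ∀ lev < (P.sched1b 1).Sd, ∀ ν, 1 ≤ ν → ν < S.n → ∀ x₁ : ℤ, |x₁| ≤ (S.NS (P.sched1b 1) (lev + 1) (ν + 1) : ℤ) →
      ∀ τ : Tau S.n, tauNorm τ + S.tS (P.sched1b 1) (lev + 1) ≤ S.TordS (P.sched1b 1) (lev + 1) ν →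
      Real.log (BwP (p := p) (P.sched1b 1).L₀ (P.sched1b 1).m) +
        Real.log (S.KC (S.UcardS₂ (P.sched1b 1)) (S.PmaxS₂ (P.sched1b 1)) (P.sched1b 1).L₀ (P.sched1b 1).H (P.sched1b 1).Sd (lev + 1)
          (S.Lb (S.sideS₂ (P.sched1b 1)) (lev + 1)) x₁ τ) <
        (((2 * S.NS (P.sched1b 1) (lev + 1) ν + 1) * S.tS (P.sched1b 1) (lev + 1) : ℕ) : ℝ) * ((((P.sched1b 1).m : ℝ) + 1 / 2) * Real.log p)) :
    ∃ b : ℝ, 1 ≤ b ∧ S.IneqPackR₃ (P.sched1b b) := by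
  have hp : p.Prime := Fact.out
  have hp3 : 3 ≤ p := by have := hp.two_le; omega
  have hpR : (3 : ℝ) ≤ p := by exact_mod_cast hp3
  have hlogp : 0 < Real.log p := Real.log_pos (by linarith)
  have hn1 : 1 ≤ S.n := by omega
  -- record facts
  have hA1 : ∀ j, 1 ≤ P.A j := fun j => by rw [hPA]; exact hV1 j
  have hΩ : P.Ω = ∏ j, V j := by unfold PadicG3Par.Ω; rw [hPA]
  have hAmax : P.Amax ≤ 2 ^ S.n * P.Ω := by rw [hΩ]; exact hAmaxΩ
  -- the headline (lp-1): 16·2ⁿ·Z ≤ (2^100)ⁿ·(p/log p)·Ω·Wp ≤ R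
  have hhead := P.headline_odd1_div_log_lit hn2 hm hθ hNq hAmax hA1
  set Z : ℝ := P.G * P.X * P.L with hZ
  set R : ℝ := ((2 : ℝ) ^ 100) ^ S.n * ((p : ℝ) / Real.log p) * (∏ j, V j) * (W + Real.log p + Real.log (2 * Vmax)) with hR
  have hWp : P.Wp ≤ W + Real.log p + Real.log (2 * Vmax) := by
    unfold PadicG3Par.Wp
    rw [hPW, hPp]
    have hA1' : 1 ≤ P.Amax := P.hAmax1
    have : Real.log (2 * P.Amax) ≤ Real.log (2 * Vmax) := Real.log_le_log (by linarith) (by linarith)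
    linarith
  have hheadR : 16 * 2 ^ S.n * Z ≤ R := by
    have h1 : 2 * (8 * 2 ^ S.n * Z) ≤ ((2 : ℝ) ^ 100) ^ S.n * ((P.p : ℝ) / Real.log P.p) * P.Ω * P.Wp := by rw [hZ]; exact hhead
    have hprodV : 0 ≤ ∏ j, V j := Finset.prod_nonneg fun j _ => le_trans zero_le_one (hV1 j)
    have h2 : ((2 : ℝ) ^ 100) ^ S.n * ((P.p : ℝ) / Real.log P.p) * P.Ω * P.Wp ≤ R := by
      rw [hR, hPp, hΩ]
      exact mul_le_mul_of_nonneg_left hWp (by positivity)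
    linarith
  -- sizes: W ≤ Z/64, log p ≤ Z/1152
  have hWZ : W ≤ Z / 64 := by rw [hZ, ← hPW]; exact P.W_le_Z
  have hG16 := P.sixteen_le_G
  have hX72 := P.seventytwo_le_X
  have hL25 := P.two_pow_25_le_L
  have hG0 : (0 : ℝ) ≤ P.G := by linarith
  have hZbig : Real.log p ≤ Z / 1152 := by
    have hGlog : (3 / 2) * Real.log P.p ≤ P.G := P.log_p_le_G_of_m_pos hm hθ
    rw [hPp] at hGlog
    have h1 : (1152 : ℝ) ≤ P.X * P.L := by
      have h72 : (72 : ℝ) * (2 : ℝ) ^ 25 ≤ P.X * P.L := mul_le_mul hX72 hL25 (by positivity) (by linarith)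
      have : (1152 : ℝ) ≤ 72 * (2 : ℝ) ^ 25 := by norm_num
      linarith
    have h2 : P.G * 1152 ≤ P.G * (P.X * P.L) := mul_le_mul_of_nonneg_left h1 hG0
    rw [hZ, le_div_iff₀ (by norm_num)]
    have h3 : P.G * (P.X * P.L) = P.G * P.X * P.L := by ring
    linarith
  have hZ0 : 0 ≤ Z := by rw [hZ]; positivity
  -- the exponent `E := ⌊(16·2ⁿ·Z − W)/log p⌋`
  set B : ℝ := 16 * 2 ^ S.n * Z - W with hB
  have h2n : (1 : ℝ) ≤ 2 ^ S.n := one_le_pow₀ (by norm_num)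
  have hZ2 : Z ≤ 2 ^ S.n * Z := le_mul_of_one_le_left hZ0 h2n
  have hB11 : 11 * 2 ^ S.n * Z + Real.log p ≤ B := by rw [hB]; linarith
  have hBpos : 0 ≤ B := by have := hlogp.le; linarith
  set E : ℕ := ⌊B / Real.log p⌋₊ with hEdef
  have hEle : (E : ℝ) * Real.log p ≤ B := by
    have h1 : (E : ℝ) ≤ B / Real.log p := Nat.floor_le (div_nonneg hBpos hlogp.le)
    have := mul_le_mul_of_nonneg_right h1 hlogp.le
    rwa [div_mul_cancel₀ _ hlogp.ne'] at this
  have hEge : B - Real.log p ≤ (E : ℝ) * Real.log p := by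
    have h1 : B / Real.log p - 1 < (E : ℝ) := by
      have := Nat.lt_floor_add_one (B / Real.log p); linarith
    have := mul_le_mul_of_nonneg_right h1.le hlogp.le
    rw [sub_mul, one_mul, div_mul_cancel₀ _ hlogp.ne'] at this
    exact this
  have hE11 : 11 * 2 ^ S.n * (P.G * P.X * P.L) ≤ (E : ℝ) * Real.log P.p := by rw [hPp, ← hZ]; linarith
  have hE1 : 1 ≤ E := by
    have h1 : Real.log p ≤ (E : ℝ) * Real.log p := by linarith
    have : (1 : ℝ) ≤ E := by
      by_contra hc
      push Not at hc
      have : (E : ℝ) * Real.log p < 1 * Real.log p := mul_lt_mul_of_pos_right hc hlogp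
      linarith
    exact_mod_cast this
  have hΛ : ‖S.Λ / (S.b S.j₀ : ℚ_[p])‖ ≤ ((p : ℝ) ^ E)⁻¹ :=
    S.expLine_of_negBound hWb hU hE1 (by rw [hB] at hEle; linarith)
  -- assemble
  refine ⟨1, le_rfl, ?_⟩
  exact S.ineqPackR₃_of_lines (P.sched1b 1) hΛ (S.startCountR₂_sched1b_one P hPp hK₀)
    (S.hexpK0_sched1b P 1 hPp hm hθ hE11) hgainK0 (S.hexpH_sched1b P 1 hPp hm hθ hE11) hgainH
    (S.hexpO_sched1b P 1 hPp hm hθ hE11) hgainO (S.hexpK_sched1b P 1 hPp hm hθ hE11) hgainK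

end G3Setup

end Summit.ABC.StewartYu

end
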